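import Mathlib
import Summits.ValiantsHypothesis.ValiantsHypothesis.Theses.FifoMatching
import Summits.ValiantsHypothesis.ValiantsHypothesis.Theorems.FifoMatchingNNLinearDegreeCofactorHardAvoidingCounts
import Summits.ValiantsHypothesis.ValiantsHypothesis.Theorems.FifoMatchingNNLinearDegreeCofactorHardStubTopInternalComponent
import Summits.ValiantsHypothesis.ValiantsHypothesis.Theorems.FifoMatchingNNLinearDegreeCofactorHardStubLongRunInternalHard
import Summits.ValiantsHypothesis.ValiantsHypothesis.Theorems.FifoMatchingNNLinearDegreeCofactorHardShedWordAssemblyTight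
import Literature.Computability.AlgebraicComplexity.NestFreeMatchingFifo
import HarnessLib

/-!
# Crux `FifoMatching.NNLinearDegreeCofactorHard` (stmt-ValiantsHypothesis-23918) — workfile `state_keyed_counts`
# (val-idea-7 g0, LENS = dual; D-0145 line-shaped GLUE + dual-side tool statements; unregistered — desk/lead decide; critic val-idea-crit-3)

WHAT THIS FILE IS.  (1) The 30-line composition, BY NAME, from the counts that ANY state-keyed queue word must deliver
(`stub_avoidingCounts28` = VERBATIM the hypothesis of p3's `InternalCofactor.denseInternalHard_of_counts` with `a = 28`) to S2b and to
the crux decl `Theses.FifoMatching.NNLinearDegreeCofactorHard` (S1 = `InternalCofactor.stub_topInternalComponent` p590074, S2a =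
`stub_longRunInternalHard` p590091, both landed) — offered to the lead (p2) / p1 (`shedWord`, memo `Lines/internal_cofactor-S2b-shed-design-p1.md`,
02:33Z) so that «assembly onto lt_complexity_of_counts ≈ 300 l.» is not re-done: it is `denseInternalHard_of_counts 28 le_rfl h` + the
registered composition.  (2) The two statements that make the DUAL side formal (memo `Lines/internal_cofactor-S2b-DUAL.md`):
`cover_forces_mass` (a universal cover of the support by k balanced splits forces mass ≥ 1/k on one of them for EVERY measure — the shape in
which a refuter lands a located infeasibility against a whole measure class) and `fifo_respects_cut` (move G2: the one-cut split is a union of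
arcs of every ballot word's FIFO pairing).  (3) `stub_rationPattern_window_free_le`, the pattern-protection count (kept for the record: it prices
named pop-free sub-windows of a defect run for words that DO pop at defects; p1's `shedWord` never pops at a defect and does not need it).

STRATEGY (why state-keyed words, in cover language).  The rectangle method at `R` proves exactly `2^{max_M c_R(M) ± O(log n)}`, `c_R(M)` = the
description length of the cheapest balanced split that is a union of arcs of `M` (LP duality = `cover_forces_mass` + the tree's
`exists_balanced_split_of_complexity_family`).  For FIFO matchings the cheap cover moves are G1 orbit threading, G2 one cut, G3 drift chains of
full blocks, G4 fresh seeds (pure-push windows).  ζ = G4 + G3 fed by `inflateWord`'s OWN ×3 pre-inflation schedule; every position/envelope-keyed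
`R ≡ pop` word is covered at `2^{O(log² n)}` that way.  A word keyed to the queue STATE — the type of the front — with sterile defect items and
driftless non-defect content offers no growth to G3 and converts no free mass for G4; the memo's audit finds no polylog cover against p1's
`shedWord` (predicted `log₂(1/t*) = Θ~(N^{1/4…1/3})`), i.e. the ∀c door through `lt_complexity_of_counts` is OPEN for that class (heuristic; the
deterministic heart is p1's (D*) transfer-cost lemma).  My own variant (V-front RATIONING: pop a non-defect-pushed front at defect positions with a
rationed probability) is DOMINATED by `shedWord` at `a ≥ 28` (it re-introduces pollution: defect-pushed items reaching the front inside a later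
run force pure-push tails; toy `sim/rationword4.py`) and is NOT filed as a line.  bears_on: stmt-ValiantsHypothesis-23918 (S2b ⇒ crux by
`NNLinearDegreeCofactorHard_of_counts28`); stmt-24468 a fortiori via `InternalCofactor.quasiPolyHard_of_counts`.  CHEAPEST FALSIFIER of the
class claim: a polylog-describable balanced split respected by `shedWord` with probability ≥ 2^{-(log N)^{C}} for one admissible `R` (attack
list A–I of the memo all fail; the live surface is arrival pricing for general σ, p1 §6.1).  INSTRUMENT: LP-dual support print-out at n ≤ 12
(p3's script, `res.ineqlin.marginals`); cover-search toy.  HONEST FRAMING (owner's, pre-wiring): sorries; nothing here proves S2b, the crux, `NNDivisionHard`,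
`NNNotVP`; monotone ≠ general (`Literature.Barriers.ValiantsHypothesis.MonotoneGap`); VP ≠ VNP is NOT moved.  AS OF THE 2026-08-28
WIRING (below): 0 sorries; `denseInternalHard_of_counts28` / `NNLinearDegreeCofactorHard_of_counts28` are now kernel terms of S2b (`a = 28`)
and of the crux obtained BY NAME from landed Theorems (the closer of record stays p606802); `NNDivisionHard`, `NNNotVP`, VP ≠ VNP untouched.

WIRED 2026-08-28 (val-width-23918-c2, director-valiant g12 R129 (a); wiring only — no statement of this file changed; sorries 2 → 0):
`stub_avoidingCounts28 := …Theorems.FifoMatching.NNLinearDegreeCofactorHard.InternalCofactor.avoidingCounts28` (p607827,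
`Theorems/FifoMatchingNNLinearDegreeCofactorHardShedWordAssemblyTight.lean`: μ* = shedWord priced at trace density 1/16 by
`ShedWordMeasureTight.pricing_large_tight` / `ShedWordMeasure.pricing_small`, rate `root16 (2M)/32` made super-logarithmic by `hr_of_root`,
assembled by LEAD p2's interface `avoidingCounts28_of_pricing` p602549 — the statement here is that theorem's, verbatim); the record count
`stub_rationPattern_window_free_le` is proved INLINE (three elementary helpers `choose_mul_pow_le_pow_mul_choose`,
`card_range_filter_window_free`, `filter_powersetCard_window_free`; no Theorems twin by ruling).  With these, `denseInternalHard_of_counts28`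
and `NNLinearDegreeCofactorHard_of_counts28` below are sorry-free kernel terms (axioms {propext, Classical.choice, Quot.sound}); the crux itself
was CLOSED·proved on the ledger by `…ShedWord.NNLinearDegreeCofactorHard_proof` (p606802, a = 1024) — this workfile is the dual-lens record, not a
second closer.  VP ≠ VNP is NOT proved.
-/

noncomputable section

-- Sub = Summit single-conjunct layout: the duplicated namespace component is mandated by the tree.
set_option linter.dupNamespace false

namespace Summit.ValiantsHypothesis.ValiantsHypothesis.Cruxes.NNLinearDegreeCofactorHard.StateKeyedCounts

open MvPolynomial Finset Literature.Computability.AlgebraicComplexity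
open Summit.ValiantsHypothesis.ValiantsHypothesis.Theorems.FifoMatching.NNLowDegreeCofactorHard.FreedVertices.Carve
open Summit.ValiantsHypothesis.ValiantsHypothesis.Theorems.FifoMatching.NNLinearDegreeCofactorHard
open Summit.ValiantsHypothesis.ValiantsHypothesis.Theorems.FifoMatching.NNLinearDegreeCofactorHard.InternalCofactor
open scoped NNReal

/-! ## Dual side (the recognised structure): covers force mass, cuts are always respected -/

/-- **Weak duality / pigeonhole.**  If every member of the support family `𝓕` respects some split from a
finite family `𝒮` (a UNIVERSAL COVER), then EVERY probability vector `μ` on `𝓕` gives some `S ∈ 𝒮` mass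
`≥ 1/|𝒮|`: a universal cover of size `k` at some admissible `R` refutes every measure at threshold `≈ k`
(located infeasibility is a cover; an exact witness is a matching family with no cheap cover). [folklore] -/
theorem cover_forces_mass {α β : Type*} [DecidableEq α] [DecidableEq β] (𝓕 : Finset α) (𝒮 : Finset β)
    (resp : α → β → Prop) [∀ M S, Decidable (resp M S)]
    (hcover : ∀ M ∈ 𝓕, ∃ S ∈ 𝒮, resp M S) (μ : α → ℝ≥0) (hμ : ∑ M ∈ 𝓕, μ M = 1) :
    ∃ S ∈ 𝒮, 1 ≤ (𝒮.card : ℝ≥0) * ∑ M ∈ 𝓕.filter (fun M => resp M S), μ M := by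
  classical
  -- the cover family is nonempty (else `𝓕 = ∅` and `hμ : 0 = 1`)
  have h𝒮 : 𝒮.Nonempty := by
    by_contra hempty
    rw [Finset.not_nonempty_iff_eq_empty] at hempty
    have hF : 𝓕 = ∅ := by
      by_contra hF
      obtain ⟨M, hM⟩ := Finset.nonempty_iff_ne_empty.mpr hF
      obtain ⟨S, hS, _⟩ := hcover M hM
      rw [hempty] at hS
      simp at hS
    rw [hF, Finset.sum_empty] at hμ
    exact zero_ne_one hμ
  -- double counting: total covered mass ≥ 1
  have h1 : (1 : ℝ≥0) ≤ ∑ S ∈ 𝒮, ∑ M ∈ 𝓕.filter (fun M => resp M S), μ M := by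
    calc (1 : ℝ≥0) = ∑ M ∈ 𝓕, μ M := hμ.symm
      _ ≤ ∑ M ∈ 𝓕, ∑ S ∈ 𝒮, (if resp M S then μ M else 0) := by
          apply Finset.sum_le_sum
          intro M hM
          obtain ⟨S, hS, hMS⟩ := hcover M hM
          calc μ M = (if resp M S then μ M else 0) := by simp [hMS]
            _ ≤ ∑ S' ∈ 𝒮, (if resp M S' then μ M else 0) :=
                Finset.single_le_sum (f := fun S' => if resp M S' then μ M else 0)
                  (fun _ _ => bot_le) hS
      _ = ∑ S ∈ 𝒮, ∑ M ∈ 𝓕, (if resp M S then μ M else 0) := Finset.sum_comm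
      _ = ∑ S ∈ 𝒮, ∑ M ∈ 𝓕.filter (fun M => resp M S), μ M := by
          refine Finset.sum_congr rfl fun S _ => ?_
          rw [Finset.sum_filter]
  -- pigeonhole
  by_contra hcon
  push Not at hcon
  have h2 : ∑ S ∈ 𝒮, (𝒮.card : ℝ≥0) * ∑ M ∈ 𝓕.filter (fun M => resp M S), μ M <
      ∑ S ∈ 𝒮, (1 : ℝ≥0) :=
    Finset.sum_lt_sum_of_nonempty h𝒮 fun S hS => hcon S hS
  rw [← Finset.mul_sum, Finset.sum_const, nsmul_eq_mul, mul_one] at h2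
  have hk : (0 : ℝ≥0) < (𝒮.card : ℝ≥0) := by exact_mod_cast Finset.card_pos.mpr h𝒮
  have h3 : ∑ S ∈ 𝒮, ∑ M ∈ 𝓕.filter (fun M => resp M S), μ M < 1 := by
    by_contra hge
    push Not at hge
    have := mul_le_mul_of_nonneg_left hge hk.le
    rw [mul_one] at this
    exact absurd h2 (not_lt.mpr this)
  exact absurd h1 (not_le.mpr h3)

/-- **(G2, generic half) the one-cut split is a union of arcs.**  For ANY word's FIFO pairing and any time `c`,
`[0,c) ∪ {closers whose partner is before c}` is respected (this is just the closure of `[0,c)` under the pairing —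
as val-idea-crit-3 noted, nothing FIFO-specific is used beyond `fifo` being an opener/closer involution; the
FIFO CONTENT — which closers those are — is `fifo_closer_lt_iff` below). [folklore] -/
theorem fifo_respects_cut {m : ℕ} (w : Fin m → Bool) (h : (closerSet w).card = (openerSet w).card)
    (hb : IsBallot w h) (c : ℕ) :
    ∀ i, i ∈ (univ.filter fun i : Fin m => i.val < c ∨ (w i = false ∧ (fifo w h i).val < c)) ↔
      fifo w h i ∈ (univ.filter fun i : Fin m => i.val < c ∨ (w i = false ∧ (fifo w h i).val < c)) := by
  intro i
  simp only [Finset.mem_filter, Finset.mem_univ, true_and, fifo_fifo]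
  -- `w (fifo i) = true ↔ w i = false` and the order of `i`, `fifo i`, from the ballot property
  by_cases hi : w i = true
  · have hlt : i < fifo w h i := (lt_fifo_iff hb i).2 hi
    have hlt' : i.val < (fifo w h i).val := hlt
    have hfi : w (fifo w h i) = false := by
      by_contra hcon
      have h1 : w (fifo w h i) = true := by simpa using hcon
      have h2 : fifo w h i < fifo w h (fifo w h i) := (lt_fifo_iff hb (fifo w h i)).2 h1
      rw [fifo_fifo] at h2
      exact lt_asymm hlt h2
    simp only [hi, hfi]
    constructor
    · rintro (h1 | ⟨h2, _⟩)
      · exact Or.inr ⟨trivial, h1⟩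
      · exact absurd h2 (by simp)
    · rintro (h1 | ⟨_, h2⟩)
      · exact Or.inl (lt_trans hlt' h1)
      · exact Or.inl h2
  · have hi' : w i = false := by simpa using hi
    have hnlt : ¬ i < fifo w h i := fun hcon => hi ((lt_fifo_iff hb i).1 hcon)
    have hne : fifo w h i ≠ i := fifo_ne i
    have hgt : (fifo w h i).val < i.val := by
      rcases lt_trichotomy (fifo w h i) i with h1 | h1 | h1
      · exact h1
      · exact absurd h1 hne
      · exact absurd h1 hnlt
    have hfi : w (fifo w h i) = true := by
      by_contra hcon
      have h1 : w (fifo w h i) = false := by simpa using hcon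
      -- then `fifo (fifo i) = i < fifo i` would make `fifo i` an opener
      have h2 : ¬ fifo w h i < fifo w h (fifo w h i) := fun hc => by
        have := (lt_fifo_iff hb (fifo w h i)).1 hc
        rw [h1] at this
        exact Bool.false_ne_true this
      rw [fifo_fifo] at h2
      exact h2 hgt
    simp only [hi', hfi]
    constructor
    · rintro (h1 | ⟨_, h2⟩)
      · exact Or.inl (lt_trans hgt h1)
      · exact Or.inl h2
    · rintro (h1 | ⟨h2, _⟩)
      · exact Or.inr ⟨trivial, h1⟩
      · exact absurd h2 (by simp)

/-- Rank lemma: the `j`-th smallest element of `t` has exactly `j` elements of `t` below it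
(proof shape of `Literature.AlgebraicGeometry.Crystalline.card_filter_lt_orderEmbOfFin_eq_val`). [folklore] -/
private theorem card_filter_lt_orderEmbOfFin {α : Type*} [LinearOrder α] (t : Finset α) {n : ℕ}
    (h : t.card = n) (j : Fin n) : (t.filter (· < t.orderEmbOfFin h j)).card = (j : ℕ) := by
  have : t.filter (· < t.orderEmbOfFin h j) =
      (Finset.Iio j).map (t.orderEmbOfFin h).toEmbedding := by
    ext x
    simp only [Finset.mem_filter, Finset.mem_map, Finset.mem_Iio, RelEmbedding.coe_toEmbedding]
    constructor
    · rintro ⟨hx, hlt⟩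
      obtain ⟨l, rfl⟩ : x ∈ Set.range (t.orderEmbOfFin h) := by
        rw [Finset.range_orderEmbOfFin]; exact hx
      exact ⟨l, (t.orderEmbOfFin h).lt_iff_lt.1 hlt, rfl⟩
    · rintro ⟨l, hl, rfl⟩
      exact ⟨Finset.orderEmbOfFin_mem _ _ _, (t.orderEmbOfFin h).lt_iff_lt.2 hl⟩
  rw [this, Finset.card_map, Fin.card_Iio]

/-- **(G2, the FIFO content.)**  For the FIFO pairing of any word, a closer `i` is matched to an opener
BEFORE the cut time `c` iff the closer-rank of `i` is below the number of openers before `c`.  Hence the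
closers of the arcs alive at `c` are exactly the NEXT `height(c) = #openers<c − #closers<c` closers at or
after `c`: the one-cut split `[0,c) ∪ {next height(c) closers}` is determined by `c` and the closer PATTERN
after `c` — its description costs ≈ the entropy of that pattern (≈ `h` bits for a thick fair queue), which is
move G2's price in the cover calculus. [folklore] -/
theorem fifo_closer_lt_iff {m : ℕ} (w : Fin m → Bool) (h : (closerSet w).card = (openerSet w).card)
    (i : Fin m) (hi : w i = false) (c : ℕ) :
    (fifo w h i).val < c ↔
      ((closerSet w).filter (fun j => j < i)).card < ((openerSet w).filter (fun j => j.val < c)).card := by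
  obtain ⟨k, rfl⟩ := exists_eq_closer h hi
  rw [fifo_closer, card_filter_lt_orderEmbOfFin]
  constructor
  · intro hlt
    -- the openers `o₀ < … < o_k` all lie before `c`
    have hsub : (Finset.Iic k).map ((openerSet w).orderEmbOfFin rfl).toEmbedding ⊆
        (openerSet w).filter (fun j => j.val < c) := by
      intro x hx
      rw [Finset.mem_map] at hx
      obtain ⟨l, hl, rfl⟩ := hx
      rw [Finset.mem_filter]
      refine ⟨Finset.orderEmbOfFin_mem _ _ _, ?_⟩
      rw [Finset.mem_Iic] at hl
      have hle : (openerSet w).orderEmbOfFin rfl l ≤ (openerSet w).orderEmbOfFin rfl k :=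
        ((openerSet w).orderEmbOfFin rfl).le_iff_le.2 hl
      exact lt_of_le_of_lt (Fin.le_def.1 hle) hlt
    have := Finset.card_le_card hsub
    rw [Finset.card_map, Fin.card_Iic] at this
    omega
  · intro hk
    by_contra hge
    push Not at hge
    -- every opener before `c` is some `o_l` with `l < k`
    have hsub : (openerSet w).filter (fun j => j.val < c) ⊆
        (Finset.Iio k).map ((openerSet w).orderEmbOfFin rfl).toEmbedding := by
      intro x hx
      rw [Finset.mem_filter] at hx
      obtain ⟨l, rfl⟩ := exists_eq_opener (mem_openerSet.1 hx.1)
      rw [Finset.mem_map]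
      refine ⟨l, ?_, rfl⟩
      rw [Finset.mem_Iio]
      by_contra hlk
      push Not at hlk
      have hle : (openerSet w).orderEmbOfFin rfl k ≤ (openerSet w).orderEmbOfFin rfl l :=
        ((openerSet w).orderEmbOfFin rfl).le_iff_le.2 hlk
      have := Fin.le_def.1 hle
      omega
    have := Finset.card_le_card hsub
    rw [Finset.card_map, Fin.card_Iio] at this
    omega

/-! ## Primal side: pattern protection (record) and the counts any state-keyed word must deliver -/

/-- **Ratio bound for binomial coefficients** (for the pattern-protection count below).  For `m ≤ n` and every `k`:
`C(m, k) · n^k ≤ m^k · C(n, k)`, i.e. `C(m,k)/C(n,k) = ∏_{i<k} (m-i)/(n-i) ≤ (m/n)^k`.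
Induction on `k` with `C(·, k+1)·(k+1) = C(·, k)·(· - k)` and `(m - k)·n ≤ m·(n - k)`. [folklore] -/
theorem choose_mul_pow_le_pow_mul_choose {m n : ℕ} (hmn : m ≤ n) :
    ∀ k : ℕ, m.choose k * n ^ k ≤ m ^ k * n.choose k
  | 0 => by simp
  | k + 1 => by
    have ih := choose_mul_pow_le_pow_mul_choose hmn k
    have hk : (m - k) * n ≤ m * (n - k) := by
      rcases Nat.lt_or_ge m k with hkm | hkm
      · rw [Nat.sub_eq_zero_of_le hkm.le, zero_mul]
        exact Nat.zero_le _
      · obtain ⟨a, rfl⟩ := Nat.exists_eq_add_of_le hkm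
        obtain ⟨b, rfl⟩ := Nat.exists_eq_add_of_le hmn
        rw [Nat.add_sub_cancel_left, show k + a + b - k = a + b by omega]
        nlinarith [Nat.zero_le (k * b)]
    have key : m.choose (k + 1) * n ^ (k + 1) * (k + 1) ≤ m ^ (k + 1) * n.choose (k + 1) * (k + 1) :=
      calc m.choose (k + 1) * n ^ (k + 1) * (k + 1)
          = (m.choose (k + 1) * (k + 1)) * n ^ k * n := by ring
        _ = m.choose k * (m - k) * n ^ k * n := by rw [Nat.choose_succ_right_eq]
        _ = (m.choose k * n ^ k) * ((m - k) * n) := by ring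
        _ ≤ (m ^ k * n.choose k) * (m * (n - k)) := Nat.mul_le_mul ih hk
        _ = m ^ (k + 1) * (n.choose k * (n - k)) := by ring
        _ = m ^ (k + 1) * (n.choose (k + 1) * (k + 1)) := by rw [Nat.choose_succ_right_eq]
        _ = m ^ (k + 1) * n.choose (k + 1) * (k + 1) := by ring
    exact Nat.le_of_mul_le_mul_right key (Nat.succ_pos k)

/-- The positions of `range I` outside the window `[u, u + w)` (with `u + w ≤ I`) number `I - w`. [folklore] -/
theorem card_range_filter_window_free (I u w : ℕ) (huw : u + w ≤ I) :
    ((range I).filter (fun x => x < u ∨ u + w ≤ x)).card = I - w := by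
  have hI : (range I).filter (fun x => x < u ∨ u + w ≤ x) = range I \ Ico u (u + w) := by
    ext x
    simp only [mem_filter, mem_sdiff, mem_range, mem_Ico]
    omega
  have hsub : Ico u (u + w) ⊆ range I := by
    intro x hx
    rw [mem_Ico] at hx
    rw [mem_range]
    omega
  rw [hI, card_sdiff_of_subset hsub, card_range, Nat.card_Ico]
  omega

/-- The `k`-subsets of `range I` avoiding the window `[u, u + w)` are exactly the `k`-subsets of the window-free
positions. [folklore] -/
theorem filter_powersetCard_window_free (I k u w : ℕ) :
    ((range I).powersetCard k).filter (fun s => ∀ x ∈ s, x < u ∨ u + w ≤ x) =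
      ((range I).filter (fun x => x < u ∨ u + w ≤ x)).powersetCard k := by
  ext s
  simp only [mem_filter, mem_powersetCard, subset_iff]
  constructor
  · rintro ⟨⟨hsub, hcard⟩, hP⟩
    exact ⟨fun x hx => ⟨hsub hx, hP x hx⟩, hcard⟩
  · rintro ⟨hsub, hcard⟩
    exact ⟨⟨fun x hx => (hsub hx).1, hcard⟩, fun x hx => (hsub hx).2⟩

/-- **First lemma (pattern protection core).**  Among the `k`-subsets of `range I` (the rationed pop positions
inside a run of `I` defect positions), those avoiding a fixed window `[u, u+w)` number `C(I-w,k)`, at most a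
`(1 - w/I)^k` fraction: a named pop-free sub-window of length `w` costs the adversary `k·w/I` nats of mass. [folklore] -/
theorem stub_rationPattern_window_free_le (I k u w : ℕ) (huw : u + w ≤ I) :
    (((range I).powersetCard k).filter (fun s => ∀ x ∈ s, x < u ∨ u + w ≤ x)).card * I ^ k ≤
      (I - w) ^ k * I.choose k := by
  rw [filter_powersetCard_window_free, card_powersetCard, card_range_filter_window_free I u w huw]
  exact choose_mul_pow_le_pow_mul_choose (Nat.sub_le I w) k

/-- **The analytic stub: AvoidingCounts(28) delivered by a STATE-KEYED word** (p1's `shedWord`: defects always push, a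
defect-pushed front is popped at the first non-defect position, fair coin otherwise, fill `H = N^{2/3}`, drain; or any sibling).
VERBATIM the hypothesis of `InternalCofactor.denseInternalHard_of_counts` (p3) with `a = 28`: for every `c`, eventually, for every
admissible `R`, every carving with good ends: seeds `BB`, a decoder `f` into the `R'`-AVOIDING nest-free perfect matchings (for
`shedWord` legal by construction: a defect never pops), and `4(2^((log₂ n+c)^c)+1)(C.m+1)² · #{y : f y respects S} < #BB` for every
balanced `S`.  Intended proof: p1's (D*) transfer-cost lemma (tests + arrivals ≥ r₀ = Θ(N^{1/4})) priced by the landed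
`CondProbSupermartingale` / `PopCountAntiConcentration` / `GateWeight` machinery; in cover language: G1 costs N/(16H) arrivals, G2 ≥ H/2
pattern bits, G3 ≥ √H·N^{-δ} aligned generations, G4 only the sterile free mass 2|R′| < N/3.  WHY IT MIGHT FAIL: arrival pricing for
general σ (p1 §6.1: a two-step bound is needed for tiny blocks); Reg indexation by fair-position rank (p1 §6.3). [folklore] -/
theorem stub_avoidingCounts28 :
    ∀ c : ℕ, ∃ n₀ : ℕ, ∀ n ≥ n₀, ∀ R : Finset (Fin (2 * n)), 28 * R.card ≤ 2 * n →
      (¬ ∃ s : ℕ, s + (2 * ((Nat.log 2 n + c) ^ c + Nat.log 2 n + 1) ^ 6 + 12) ≤ 2 * n ∧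
        ∀ j : Fin (2 * n), s ≤ j.val →
          j.val < s + (2 * ((Nat.log 2 n + c) ^ c + Nat.log 2 n + 1) ^ 6 + 12) → j ∉ R) →
      ∀ C : Carving n, 3 ≤ C.m → 2 * n ≤ 2 * C.m + 12 * R.card + 4 →
        (∀ t ≤ 2 * C.m,
          4 * ((univ.filter fun j : Fin (2 * C.m) => C.up j ∈ R).filter fun j => j.val < t).card ≤ t ∧
          4 * ((univ.filter fun j : Fin (2 * C.m) => C.up j ∈ R).filter
            fun j => 2 * C.m ≤ j.val + t).card ≤ t) →
        ∃ B : ℕ, ∃ BB : Finset (Fin B → Bool), ∃ f : (Fin B → Bool) → (Fin (2 * C.m) → Fin (2 * C.m)),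
          BB.Nonempty ∧
          (∀ y ∈ BB, f y ∈ (nestFreeMatchings (2 * C.m)).filter
            (fun N => ∀ j ∈ (univ.filter fun j : Fin (2 * C.m) => C.up j ∈ R),
              N j ∉ (univ.filter fun j : Fin (2 * C.m) => C.up j ∈ R))) ∧
          ∀ S : Finset (Fin (2 * C.m)), 2 * C.m < 3 * S.card → 3 * S.card ≤ 4 * C.m →
            (4 * (2 ^ ((Nat.log 2 n + c) ^ c) + 1) * (C.m + 1) ^ 2) *
              (BB.filter fun y => ∀ i, i ∈ S ↔ f y i ∈ S).card < BB.card :=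
  Summit.ValiantsHypothesis.ValiantsHypothesis.Theorems.FifoMatching.NNLinearDegreeCofactorHard.InternalCofactor.avoidingCounts28

/-- **S2b (`stub_denseInternalHard` of line internal_cofactor, with `a = 28`) from the counts**, by p3's landed
`denseInternalHard_of_counts`. [folklore] -/
theorem denseInternalHard_of_counts28 :
    ∃ a : ℕ, ∀ c : ℕ, ∃ n₀ : ℕ, ∀ n ≥ n₀, ∀ R : Finset (Fin (2 * n)), a * R.card ≤ 2 * n →
      (¬ ∃ s : ℕ, s + (2 * ((Nat.log 2 n + c) ^ c + Nat.log 2 n + 1) ^ 6 + 12) ≤ 2 * n ∧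
        ∀ j : Fin (2 * n), s ≤ j.val →
          j.val < s + (2 * ((Nat.log 2 n + c) ^ c + Nat.log 2 n + 1) ^ 6 + 12) → j ∉ R) →
      ∀ p : MvPolynomial (Fin (2 * n) × Fin (2 * n)) ℝ≥0, p ≠ 0 → a * p.totalDegree ≤ n →
        (∀ d ∈ p.support, ∀ e ∈ d.support, e.1 ∈ R ∧ e.2 ∈ R) →
          2 ^ ((Nat.log 2 n + c) ^ c) < complexity (nestFreeMatchingPoly n ℝ≥0 * p) :=
  ⟨28, denseInternalHard_of_counts 28 le_rfl stub_avoidingCounts28⟩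

/-- **The line concludes the crux BY NAME**: S1 (`InternalCofactor.stub_topInternalComponent`, landed p590074) +
S2a (`stub_longRunInternalHard`, landed p590091) + S2b from the counts; composition as in the registered
skeleton `Lines/internal_cofactor.lean`. [folklore] -/
theorem NNLinearDegreeCofactorHard_of_counts28 :
    Summit.ValiantsHypothesis.ValiantsHypothesis.Theses.FifoMatching.NNLinearDegreeCofactorHard := by
  obtain ⟨a, ha⟩ := denseInternalHard_of_counts28
  refine ⟨a, fun c => ?_⟩
  obtain ⟨n₁, hn₁⟩ := stub_longRunInternalHard c
  obtain ⟨n₂, hn₂⟩ := ha c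
  refine ⟨max n₁ n₂, fun n hn h hh hdeg => ?_⟩
  obtain ⟨R, hR, p, hp, hpdeg, hint, hpc⟩ := InternalCofactor.stub_topInternalComponent n h hh
  have hRa : a * R.card ≤ 2 * n :=
    calc a * R.card ≤ a * (2 * h.totalDegree) := Nat.mul_le_mul_left a hR
      _ = 2 * (a * h.totalDegree) := by ring
      _ ≤ 2 * n := Nat.mul_le_mul_left 2 hdeg
  have hpa : a * p.totalDegree ≤ n := (Nat.mul_le_mul_left a hpdeg).trans hdeg
  have key : 2 ^ ((Nat.log 2 n + c) ^ c) < complexity (nestFreeMatchingPoly n ℝ≥0 * p) := by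
    by_cases hrun : ∃ s : ℕ, s + (2 * ((Nat.log 2 n + c) ^ c + Nat.log 2 n + 1) ^ 6 + 12) ≤ 2 * n ∧
        ∀ j : Fin (2 * n), s ≤ j.val →
          j.val < s + (2 * ((Nat.log 2 n + c) ^ c + Nat.log 2 n + 1) ^ 6 + 12) → j ∉ R
    · exact hn₁ n (le_of_max_le_left hn) R hrun p hp hint
    · exact hn₂ n (le_of_max_le_right hn) R hRa hrun p hp hpa hint
  show 2 ^ ((Nat.log 2 n + c) ^ c) <
    complexity (nestFreeMatchingPoly n ℝ≥0 * h) + complexity h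
  calc 2 ^ ((Nat.log 2 n + c) ^ c) < complexity (nestFreeMatchingPoly n ℝ≥0 * p) := key
    _ ≤ complexity (nestFreeMatchingPoly n ℝ≥0 * h) := hpc
    _ ≤ complexity (nestFreeMatchingPoly n ℝ≥0 * h) + complexity h := Nat.le_add_right _ _

end Summit.ValiantsHypothesis.ValiantsHypothesis.Cruxes.NNLinearDegreeCofactorHard.StateKeyedCounts

end
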